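import Summits.Ventures.LatticeQCDFlow.Scaling.HubClassChainDictionary
import Summits.Ventures.LatticeQCDFlow.Scaling.HubClassChainResolvent

/-!
HONEST FRAMING: exact (Metropolis-corrected) sampling algorithms for lattice gauge theory; figures
of merit are autocorrelation/cost numbers at stated couplings and volumes; no continuum-physics
claim.

# HubClassChainResolventDictionary — CHAPTER W'S END-HUB LAW `u = (1−σ)δ_z + σ·u·Kh(N;·,·)` IN CLOSED FORM ON THE CONTENTS: FOR ANY PERSISTENCE-SORTED ENUMERATION `e` OF THE CONTENTS
# PRESENT, `u(e_j) = (N(e_j)/W(e_j))·𝒯(max(i₀,j)) + γ_jδ_{i₀j}` (`z = e_{i₀}`), `𝒯(j) = (1−γ_j)/R_m + Σ_{j<k<m}(1/R_k − 1/R_{k+1})(γ_k − γ_j)`, `γ_k = (1−σ)/(1−σβ_k)`; ABSENT CONTENTS CARRY NO MASS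
# (lean-2 GEN-39, ours)

Venture-side (OURS).  Cell `lqcd-flow` (pub-lqcd), unit `pub-lqcd-lean-2-g39`, 2026-08-30.  Chapter Y, file 13 = file 12 for the resolvent.  Chapter W pins the end-hub law of a refresh cycle from hub
content `z` by `u(v) = (1−σ)𝟙{v = z} + σΣ_h u(h)Kh(N;h,v)` on ALL of `S` (e.g. `FiniteOddsLaw`, hypothesis `hu`).  Here, with the hypotheses on `Kh` verbatim and an enumeration `e` of the
contents present sorted by non-increasing `W` (`z = e_{i₀}`):

* `resDict_absent`: `u(v) = 0` for absent `v` (`N(v) = 0`);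
* `resDict_rank_equation`: on the ranks `u(e_j) = (1−σ)δ_{i₀j} + σΣ_{l<m}u(e_l)Kh(N;e_l,e_j)`;
* **`resDict_closed`**: `u(e_j) = (N(e_j)/W(e_j))·(1/R_m + Σ_{k<m}γ_kf_k(i₀)f_k(j)N_k/(ρ_kR_kR_{k+1}))` — via file 11 on the internal `ℕ`-indexed class chain of file 12;
* **`resDict_offdiag`** ∕ **`resDict_diag`**: the Smith–Tierney form `u(e_j) = (N(e_j)/W(e_j))·𝒯(max(i₀,j))` (`j ≠ i₀`), `u(e_{i₀}) = (N(e_{i₀})/W(e_{i₀}))𝒯(i₀) + γ_{i₀}`,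
  with `R_k = Σ_{l<k}N(e_l)/W(e_l)`, `M_k = Σ_{k≤l<m}N(e_l)`, `β_k = 1 − (1/K)(M_k + R_kW(e_k))`, `γ_k = (1−σ)/(1−σβ_k)` (hypothesis-equations on the ranks only).

Reading (no numerics implied): every value `ũ(w)`, `x̃(★)`… of MEMO-gen37's criterion is an explicit rational function of the depths and class sizes; e.g. the cycle-end hub content equals
the start content with probability `u(z) = (N(z)/W(z))𝒯(rank z) + γ_{rank z}`.  Literature grade (cell rule): OWN, plumbing; nothing cited; no new bib keys.
-/

open Finset

namespace Summit.Ventures.LatticeQCDFlow.Scaling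

section ResDict
variable {S : Type*} [Fintype S] [DecidableEq S]
variable {W : S → ℝ} {acc : S → S → ℝ} {Kh : (S → ℕ) → S → S → ℝ} {K : ℕ} {N : S → ℕ} {e : ℕ → S} {m : ℕ} {σ : ℝ} {u : S → ℝ} {i₀ : ℕ}

/-- **Absent contents carry no resolvent mass:** `N(v) = 0 ⇒ u(v) = 0` (`σ < 1`; the start `z = e_{i₀}` is present). [ours] -/
theorem resDict_absent (hKoff : ∀ N h v, h ≠ v → Kh N h v = if N h = 0 then 0 else (N v : ℝ) / K * acc h v)
    (hKdiag : ∀ N h, Kh N h h = 1 - ∑ v ∈ univ.erase h, Kh N h v) (he_pres : ∀ i, i < m → N (e i) ≠ 0) (hi₀ : i₀ < m) (hσ1 : σ < 1)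
    (hu : ∀ v, u v = (1 - σ) * (if v = e i₀ then 1 else 0) + σ * ∑ h, u h * Kh N h v) {v : S} (hv : N v = 0) : u v = 0 := by
  classical
  have hvz : v ≠ e i₀ := fun h => he_pres i₀ hi₀ (h ▸ hv)
  have hKvv : Kh N v v = 1 := by
    rw [hKdiag]
    have : ∑ w ∈ univ.erase v, Kh N v w = 0 := sum_eq_zero fun w hw => by
      rw [hKoff N v w (ne_of_mem_erase hw).symm, if_pos hv]
    rw [this]; ring
  have h := hu v
  rw [if_neg hvz, mul_zero, zero_add, ← Finset.add_sum_erase _ _ (mem_univ v), hKvv, mul_one] at h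
  have hrest : ∑ h ∈ univ.erase v, u h * Kh N h v = 0 := sum_eq_zero fun h hh => by
    rw [dict_Kh_absent hKoff hv (ne_of_mem_erase hh), mul_zero]
  rw [hrest, add_zero] at h
  nlinarith

/-- **The resolvent equation closes on the ranks:** `u(e_j) = (1−σ)δ_{i₀j} + σΣ_{l<m}u(e_l)Kh(N;e_l,e_j)` for `j < m`. [ours] -/
theorem resDict_rank_equation (hKoff : ∀ N h v, h ≠ v → Kh N h v = if N h = 0 then 0 else (N v : ℝ) / K * acc h v)
    (hKdiag : ∀ N h, Kh N h h = 1 - ∑ v ∈ univ.erase h, Kh N h v)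
    (he_inj : ∀ i j, i < m → j < m → e i = e j → i = j) (he_pres : ∀ i, i < m → N (e i) ≠ 0) (he_cov : ∀ v, N v ≠ 0 → ∃ i, i < m ∧ e i = v)
    (hi₀ : i₀ < m) (hσ1 : σ < 1)
    (hu : ∀ v, u v = (1 - σ) * (if v = e i₀ then 1 else 0) + σ * ∑ h, u h * Kh N h v) {j : ℕ} (hj : j < m) :
    u (e j) = (1 - σ) * (if i₀ = j then 1 else 0) + σ * ∑ l ∈ range m, u (e l) * Kh N (e l) (e j) := by
  rw [hu (e j)]
  have e1 : (if e j = e i₀ then (1:ℝ) else 0) = if i₀ = j then 1 else 0 := by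
    by_cases h : i₀ = j
    · rw [if_pos h, if_pos (by rw [h])]
    · rw [if_neg h, if_neg (fun h' => h (he_inj i₀ j hi₀ hj h'.symm))]
  have e2 : ∑ h, u h * Kh N h (e j) = ∑ l ∈ range m, u (e l) * Kh N (e l) (e j) :=
    dict_sum_present he_inj he_cov fun w hw => by rw [resDict_absent hKoff hKdiag he_pres hi₀ hσ1 hu hw, zero_mul]
  rw [e1, e2]

/-- The Smith–Tierney form of chapter W's end-hub law on the contents (both cases packaged). -/
theorem resDict_form (hW : ∀ v, 0 < W v) (hacc : ∀ h v, acc h v = min 1 (W h / W v)) (hK : 1 ≤ K)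
    (hKoff : ∀ N h v, h ≠ v → Kh N h v = if N h = 0 then 0 else (N v : ℝ) / K * acc h v)
    (hKdiag : ∀ N h, Kh N h h = 1 - ∑ v ∈ univ.erase h, Kh N h v)
    (hKtot : ∀ v, N v ≠ 0 → (∑ w, (N w : ℝ)) - N v ≤ K)
    (he_inj : ∀ i j, i < m → j < m → e i = e j → i = j) (he_pres : ∀ i, i < m → N (e i) ≠ 0) (he_cov : ∀ v, N v ≠ 0 → ∃ i, i < m ∧ e i = v)
    (hsorted : ∀ i j, i ≤ j → j < m → W (e j) ≤ W (e i)) (hi₀ : i₀ < m) (hσ0 : 0 ≤ σ) (hσ1 : σ < 1)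
    (hu : ∀ v, u v = (1 - σ) * (if v = e i₀ then 1 else 0) + σ * ∑ h, u h * Kh N h v)
    {R M β γ : ℕ → ℝ} {Tr : ℕ → ℝ}
    (hR : ∀ k, k ≤ m → R k = ∑ l ∈ range k, (N (e l) : ℝ) / W (e l)) (hM : ∀ k, k ≤ m → M k = ∑ l ∈ Ico k m, (N (e l) : ℝ))
    (hβ : ∀ k, k < m → β k = 1 - 1 / K * (M k + R k * W (e k))) (hγ : ∀ k, k < m → γ k = (1 - σ) / (1 - σ * β k))
    (hTr : ∀ j, j < m → Tr j = (1 - γ j) / R m + ∑ k ∈ Ico (j + 1) m, (1 / R k - 1 / R (k + 1)) * (γ k - γ j))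
    {j : ℕ} (hj : j < m) :
    (i₀ ≠ j → u (e j) = (N (e j) : ℝ) / W (e j) * Tr (max i₀ j)) ∧ (i₀ = j → u (e j) = (N (e j) : ℝ) / W (e j) * Tr j + γ j) := by
  classical
  have hm : 1 ≤ m := by omega
  -- the internal ℕ-indexed class chain (as in file 12)
  let ρ' : ℕ → ℝ := fun l => 1 / W (e (min l (m - 1)))
  let N' : ℕ → ℝ := fun l => if l < m then (N (e l) : ℝ) else 1
  have hρ'eq : ∀ l, l < m → ρ' l = 1 / W (e l) := fun l hl => by simp only [ρ']; rw [min_eq_left (by omega)]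
  have hN'eq : ∀ l, l < m → N' l = (N (e l) : ℝ) := fun l hl => by simp only [N']; rw [if_pos hl]
  have hρ' : ∀ l, 0 < ρ' l := fun l => by simp only [ρ']; exact div_pos one_pos (hW _)
  have hN' : ∀ l, 0 < N' l := by
    intro l; simp only [N']; split_ifs with h
    · exact_mod_cast Nat.pos_of_ne_zero (he_pres l h)
    · exact one_pos
  have hmono' : Monotone ρ' := by
    intro a b hab; simp only [ρ']
    exact one_div_le_one_div_of_le (hW _) (hsorted _ _ (min_le_min hab le_rfl) (by omega))
  let c : ℝ := 1 / K
  have hc : 0 ≤ c := by simp only [c]; positivity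
  let R' : ℕ → ℝ := fun k => ∑ l ∈ range k, N' l * ρ' l
  let M' : ℕ → ℝ := fun k => ∑ l ∈ Ico k m, N' l
  let β' : ℕ → ℝ := fun k => 1 - c * (M' k + R' k / ρ' k)
  let γ' : ℕ → ℝ := fun k => (1 - σ) / (1 - σ * β' k)
  let f' : ℕ → ℕ → ℝ := fun k l => if l < k then ρ' k else if l = k then -(R' k / N' k) else 0
  let Tr' : ℕ → ℝ := fun j => (1 - γ' j) / R' m + ∑ k ∈ Ico (j + 1) m, (1 / R' k - 1 / R' (k + 1)) * (γ' k - γ' j)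
  let Q : ℕ → ℕ → ℝ := fun a b => if a < m ∧ b < m then Kh N (e a) (e b) else c * N' b * min 1 (ρ' b / ρ' a)
  let P' : ℕ → ℕ → ℝ := fun a b => if a = b then 1 - ∑ l ∈ (range m).erase a, Q a l else Q a b
  -- agreement with the user's data
  have hR'eq : ∀ k, k ≤ m → R' k = R k := by
    intro k hk; rw [hR k hk]; simp only [R']
    exact sum_congr rfl fun l hl => by have := mem_range.mp hl; rw [hN'eq l (by omega), hρ'eq l (by omega)]; ring
  have hM'eq : ∀ k, k ≤ m → M' k = M k := by
    intro k hk; rw [hM k hk]; simp only [M']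
    exact sum_congr rfl fun l hl => by have := (mem_Ico.mp hl).2; rw [hN'eq l this]
  have hβ'eq : ∀ k, k < m → β' k = β k := by
    intro k hk; rw [hβ k hk]; simp only [β']; rw [hM'eq k hk.le, hR'eq k hk.le, hρ'eq k hk]
    have := (hW (e k)).ne'; simp only [c]; field_simp
  have hγ'eq : ∀ k, k < m → γ' k = γ k := by intro k hk; rw [hγ k hk]; simp only [γ']; rw [hβ'eq k hk]
  have hTr'eq : ∀ j, j < m → Tr' j = Tr j := by
    intro j hj; rw [hTr j hj]; simp only [Tr']; rw [hγ'eq j hj, hR'eq m le_rfl]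
    congr 1
    exact sum_congr rfl fun k hk => by
      have hk' := mem_Ico.mp hk
      rw [hR'eq k (by omega), hR'eq (k + 1) (by omega), hγ'eq k hk'.2]
  -- class-chain hypotheses for `P'`
  have hQ_in : ∀ a b, a < m → b < m → Q a b = Kh N (e a) (e b) := fun a b ha hb => if_pos ⟨ha, hb⟩
  have hQ_out : ∀ a b, ¬ (a < m ∧ b < m) → Q a b = c * N' b * min 1 (ρ' b / ρ' a) := fun a b h => if_neg h
  have hP'off : ∀ a b, a ≠ b → P' a b = Q a b := fun a b hab => if_neg hab
  have hP'on : ∀ a, P' a a = 1 - ∑ l ∈ (range m).erase a, Q a l := fun a => if_pos rfl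
  have hPoff' : ∀ a b, a ≠ b → P' a b = c * N' b * min 1 (ρ' b / ρ' a) := by
    intro a b hab
    rw [hP'off a b hab]
    by_cases h : a < m ∧ b < m
    · rw [hQ_in a b h.1 h.2, dict_Kh_offdiag hW hacc hKoff he_inj he_pres h.1 h.2 hab, hN'eq b h.2, hρ'eq a h.1, hρ'eq b h.2]
    · exact hQ_out a b h
  have hPdiag' : ∀ a, P' a a = 1 - ∑ l ∈ (range m).erase a, P' a l := by
    intro a; rw [hP'on a]
    congr 1
    exact sum_congr rfl fun l hl => by rw [hP'off a l (ne_of_mem_erase hl).symm]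
  have hP'Kh : ∀ a b, a < m → b < m → P' a b = Kh N (e a) (e b) := by
    intro a b ha hb
    by_cases hab : a = b
    · subst hab
      rw [hPdiag' a, dict_Kh_diag hKoff hKdiag he_inj he_pres he_cov ha]
      congr 1
      exact sum_congr rfl fun l hl => by
        have hl' : l < m := mem_range.mp (mem_of_mem_erase hl)
        rw [hP'off a l (ne_of_mem_erase hl).symm, hQ_in a l ha hl']
    · rw [hP'off a b hab, hQ_in a b ha hb]
  -- `c(M_0 − N_k) ≤ 1` from the composition size
  have hcm' : ∀ k, k < m → c * (M' 0 - N' k) ≤ 1 := by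
    intro k hk
    have hM0 : M' 0 = ∑ w, (N w : ℝ) := by
      simp only [M']
      rw [show (Ico 0 m) = range m from by ext; simp]
      rw [dict_sum_present (F := fun w => (N w : ℝ)) he_inj he_cov (fun v hv => by rw [hv]; simp)]
      exact sum_congr rfl fun l hl => hN'eq l (mem_range.mp hl)
    rw [hM0, hN'eq k hk]
    have h := hKtot (e k) (he_pres k hk)
    have hKpos : (0:ℝ) < K := by exact_mod_cast hK
    simp only [c]
    rw [div_mul_eq_mul_div, one_mul, div_le_one hKpos]
    exact h
  -- the ℕ-indexed resolvent: the user's `u` on row `i₀`, the closed form on other present rows, zero elsewhere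
  let CF : ℕ → ℕ → ℝ := fun a b => N' b * ρ' b * (1 / R' m + ∑ k ∈ range m, γ' k * (f' k a * f' k b * N' k) / (ρ' k * R' k * R' (k + 1)))
  let u' : ℕ → ℕ → ℝ := fun a b => if a = i₀ then u (e b) else if a < m then CF a b else 0
  have hR'h : ∀ k, R' k = ∑ l ∈ range k, N' l * ρ' l := fun _ => rfl
  have hM'h : ∀ k, M' k = ∑ l ∈ Ico k m, N' l := fun _ => rfl
  have hβ'h : ∀ k, β' k = 1 - c * (M' k + R' k / ρ' k) := fun _ => rfl
  have hγ'h : ∀ k, γ' k = (1 - σ) / (1 - σ * β' k) := fun _ => rfl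
  have hf'h : ∀ k l, f' k l = if l < k then ρ' k else if l = k then -(R' k / N' k) else 0 := fun _ _ => rfl
  have hTr'h : ∀ j, Tr' j = (1 - γ' j) / R' m + ∑ k ∈ Ico (j + 1) m, (1 / R' k - 1 / R' (k + 1)) * (γ' k - γ' j) := fun _ => rfl
  have hu' : ∀ a b, b < m → u' a b = (1 - σ) * (if a = b then 1 else 0) + σ * ∑ l ∈ range m, u' a l * P' l b := by
    intro a b hb
    have hrow0 : ∀ b', u' i₀ b' = u (e b') := fun b' => if_pos rfl
    by_cases ha0 : a = i₀
    · rw [ha0, hrow0, resDict_rank_equation hKoff hKdiag he_inj he_pres he_cov hi₀ hσ1 hu hb]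
      congr 1
      congr 1
      exact sum_congr rfl fun l hl => by rw [hrow0, hP'Kh l b (mem_range.mp hl) hb]
    · by_cases ha : a < m
      · have e1 : ∀ b', u' a b' = CF a b' := fun b' => by simp only [u']; rw [if_neg ha0, if_pos ha]
        simp_rw [e1]
        exact hubClass_resolvent_solves hρ' hmono' hN' hR'h hM'h hPoff' hPdiag' hf'h hβ'h hc hσ0 hσ1 hγ'h ha hb
      · have e1 : ∀ b', u' a b' = 0 := fun b' => by simp only [u']; rw [if_neg ha0, if_neg ha]
        simp_rw [e1]
        rw [if_neg (by omega : a ≠ b)]; simp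
  have hclosed := hubClass_resolvent_eq hρ' hmono' hN' hR'h hM'h hPoff' hPdiag' hf'h hβ'h hc hcm' hσ0 hσ1 hγ'h hu' hi₀ hj
  have hu'i : u' i₀ j = u (e j) := if_pos rfl
  refine ⟨fun hij => ?_, fun hij => ?_⟩
  · have h := hubClass_resolvent_offdiag hρ' hmono' hN' hR'h hM'h hPoff' hPdiag' hf'h hβ'h hc hcm' hσ0 hσ1 hγ'h hu' hTr'h hi₀ hj hij
    rw [hu'i, hN'eq j hj, hρ'eq j hj, hTr'eq _ (max_lt hi₀ hj)] at h
    rw [h]; ring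
  · subst hij
    have h := hubClass_resolvent_diag hρ' hmono' hN' hR'h hM'h hPoff' hPdiag' hf'h hβ'h hc hcm' hσ0 hσ1 hγ'h hu' hTr'h hi₀
    rw [hu'i, hN'eq i₀ hi₀, hρ'eq i₀ hi₀, hTr'eq i₀ hi₀, hγ'eq i₀ hi₀] at h
    have _ := hclosed
    rw [h]; ring

/-- **CHAPTER W'S END-HUB LAW IN CLOSED FORM, off the start:** `u(e_j) = (N(e_j)/W(e_j))·𝒯(max(i₀,j))` for a present rank `j ≠ i₀`. [ours] -/
theorem resDict_offdiag (hW : ∀ v, 0 < W v) (hacc : ∀ h v, acc h v = min 1 (W h / W v)) (hK : 1 ≤ K)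
    (hKoff : ∀ N h v, h ≠ v → Kh N h v = if N h = 0 then 0 else (N v : ℝ) / K * acc h v)
    (hKdiag : ∀ N h, Kh N h h = 1 - ∑ v ∈ univ.erase h, Kh N h v)
    (hKtot : ∀ v, N v ≠ 0 → (∑ w, (N w : ℝ)) - N v ≤ K)
    (he_inj : ∀ i j, i < m → j < m → e i = e j → i = j) (he_pres : ∀ i, i < m → N (e i) ≠ 0) (he_cov : ∀ v, N v ≠ 0 → ∃ i, i < m ∧ e i = v)
    (hsorted : ∀ i j, i ≤ j → j < m → W (e j) ≤ W (e i)) (hi₀ : i₀ < m) (hσ0 : 0 ≤ σ) (hσ1 : σ < 1)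
    (hu : ∀ v, u v = (1 - σ) * (if v = e i₀ then 1 else 0) + σ * ∑ h, u h * Kh N h v)
    {R M β γ : ℕ → ℝ} {Tr : ℕ → ℝ}
    (hR : ∀ k, k ≤ m → R k = ∑ l ∈ range k, (N (e l) : ℝ) / W (e l)) (hM : ∀ k, k ≤ m → M k = ∑ l ∈ Ico k m, (N (e l) : ℝ))
    (hβ : ∀ k, k < m → β k = 1 - 1 / K * (M k + R k * W (e k))) (hγ : ∀ k, k < m → γ k = (1 - σ) / (1 - σ * β k))
    (hTr : ∀ j, j < m → Tr j = (1 - γ j) / R m + ∑ k ∈ Ico (j + 1) m, (1 / R k - 1 / R (k + 1)) * (γ k - γ j))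
    {j : ℕ} (hj : j < m) (hij : i₀ ≠ j) : u (e j) = (N (e j) : ℝ) / W (e j) * Tr (max i₀ j) :=
  (resDict_form hW hacc hK hKoff hKdiag hKtot he_inj he_pres he_cov hsorted hi₀ hσ0 hσ1 hu hR hM hβ hγ hTr hj).1 hij

/-- **CHAPTER W'S END-HUB LAW IN CLOSED FORM, at the start:** `u(e_{i₀}) = (N(e_{i₀})/W(e_{i₀}))·𝒯(i₀) + γ_{i₀}`. [ours] -/
theorem resDict_diag (hW : ∀ v, 0 < W v) (hacc : ∀ h v, acc h v = min 1 (W h / W v)) (hK : 1 ≤ K)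
    (hKoff : ∀ N h v, h ≠ v → Kh N h v = if N h = 0 then 0 else (N v : ℝ) / K * acc h v)
    (hKdiag : ∀ N h, Kh N h h = 1 - ∑ v ∈ univ.erase h, Kh N h v)
    (hKtot : ∀ v, N v ≠ 0 → (∑ w, (N w : ℝ)) - N v ≤ K)
    (he_inj : ∀ i j, i < m → j < m → e i = e j → i = j) (he_pres : ∀ i, i < m → N (e i) ≠ 0) (he_cov : ∀ v, N v ≠ 0 → ∃ i, i < m ∧ e i = v)
    (hsorted : ∀ i j, i ≤ j → j < m → W (e j) ≤ W (e i)) (hi₀ : i₀ < m) (hσ0 : 0 ≤ σ) (hσ1 : σ < 1)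
    (hu : ∀ v, u v = (1 - σ) * (if v = e i₀ then 1 else 0) + σ * ∑ h, u h * Kh N h v)
    {R M β γ : ℕ → ℝ} {Tr : ℕ → ℝ}
    (hR : ∀ k, k ≤ m → R k = ∑ l ∈ range k, (N (e l) : ℝ) / W (e l)) (hM : ∀ k, k ≤ m → M k = ∑ l ∈ Ico k m, (N (e l) : ℝ))
    (hβ : ∀ k, k < m → β k = 1 - 1 / K * (M k + R k * W (e k))) (hγ : ∀ k, k < m → γ k = (1 - σ) / (1 - σ * β k))
    (hTr : ∀ j, j < m → Tr j = (1 - γ j) / R m + ∑ k ∈ Ico (j + 1) m, (1 / R k - 1 / R (k + 1)) * (γ k - γ j)) :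
    u (e i₀) = (N (e i₀) : ℝ) / W (e i₀) * Tr i₀ + γ i₀ :=
  (resDict_form hW hacc hK hKoff hKdiag hKtot he_inj he_pres he_cov hsorted hi₀ hσ0 hσ1 hu hR hM hβ hγ hTr hi₀).2 rfl

end ResDict

end Summit.Ventures.LatticeQCDFlow.Scaling
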